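import Summits.KontsevichZagierPeriods.KontsevichZagierPeriods.Theorems.SoloBlindSecondAsymp
import HarnessLib

/-!
# The second-kind form, IV: integrability of `Re g'` on the half-plane

With the cancellation bound `|g'(z)| ≤ 16(2+|μ|)|z|^{σ-2}` (`|z| ≥ 2`) of
`SoloBlindSecondAsymp` and the crude bounds near the origin, `|g'(x+iy)|` is dominated on
`D = {x < ½, y > 0}` by the radial profile `B r^{σ-1}` (`r ≤ 1`), `C r^{σ-2}` (`r > 1`) in the
sup norm `r = ‖(x,y)‖`, which is integrable in the plane exactly when `-1 < σ < 0` — the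
second-kind range.  Hence `h = Re g'` is an admissible `2`-dimensional Kontsevich–Zagier
integrand on `D`.
-/

noncomputable section

open Set Complex MeasureTheory Filter
open scoped Topology
open Literature.NumberTheory.Transcendental
open Literature.NumberTheory.Transcendental.KZ

namespace Summit.KontsevichZagierPeriods.KontsevichZagierPeriods.Theorems

namespace SoloBlind

/-! ## The radial profile -/

/-- The crude constant `B = 6 + |λ| + 8|μ|`. -/
def crudeK (l m : ℝ) : ℝ := 6 + |l| + 8 * |m|

/-- The dominating radial profile of the second-kind form. -/
def profK (α β l m r : ℝ) : ℝ :=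
  if r ≤ 1 then crudeK l m * r ^ (α + β - 1)
  else (8 * crudeK l m + 16 * (2 + |m|)) * r ^ (α + β - 2)

/-- The crude pointwise bound `|g'(ζ)| ≤ |g_{αβ}'(ζ)| + |λ| |ζ|^{σ-1} + 8|μ|` on `Re ζ < ½`
(`σ ∈ [-1, 0]`). -/
theorem norm_gKDer_le_crude {α β : ℝ} (l m : ℝ) (hs : -1 ≤ α + β) (hs0 : α + β ≤ 0) {ζ : ℂ}
    (hx : ζ.re < 1 / 2) :
    ‖gKDer α β l m ζ‖ ≤ ‖gTwoDer α β ζ‖ + |l| * ‖ζ‖ ^ (α + β - 1) + 8 * |m| := by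
  have hσ : ‖((α + β : ℝ) : ℂ)‖ ≤ 1 := norm_ofReal_le_one hs hs0
  have h1 : ‖(l : ℂ) * (((α + β : ℝ) : ℂ) * ζ ^ (((α + β : ℝ) : ℂ) - 1))‖ ≤
      |l| * ‖ζ‖ ^ (α + β - 1) := by
    rw [norm_mul, norm_mul, norm_real, Real.norm_eq_abs, norm_cpow_ofReal_sub_one]
    calc |l| * (‖((α + β : ℝ) : ℂ)‖ * ‖ζ‖ ^ (α + β - 1)) ≤ |l| * (1 * ‖ζ‖ ^ (α + β - 1)) := by
          gcongr
      _ = _ := by ring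
  have h2 : ‖(m : ℂ) * (((α + β : ℝ) : ℂ) * (1 - ζ) ^ (((α + β : ℝ) : ℂ) - 1))‖ ≤ 8 * |m| := by
    rw [norm_mul, norm_mul, norm_real, Real.norm_eq_abs, norm_cpow_ofReal_sub_one]
    have h8 : ‖1 - ζ‖ ^ (α + β - 1) ≤ 8 :=
      (Real.rpow_le_rpow_of_nonpos (by norm_num) (half_le_norm_one_sub hx) (by linarith)).trans
        (half_rpow_le_eight (by linarith))
    calc |m| * (‖((α + β : ℝ) : ℂ)‖ * ‖1 - ζ‖ ^ (α + β - 1)) ≤ |m| * (1 * 8) := by gcongr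
      _ = 8 * |m| := by ring
  rw [gKDer]
  exact (norm_add_le _ _).trans (add_le_add ((norm_sub_le _ _).trans (add_le_add le_rfl h1)) h2)

/-- **Radial domination**: `|g'(x+iy)| ≤ profK(‖(x,y)‖)` on `x < ½`, `y > 0`, under the
cancellation conditions. -/
theorem norm_gKDer_le_profK {α β l m : ℝ} (hα : -1 ≤ α) (hα0 : α ≤ 0) (hβ : -1 ≤ β)
    (hβ0 : β ≤ 0) (hs : -1 ≤ α + β) (hs0 : α + β ≤ 0)
    (hK : ephase β - l - m * ephase (α + β) = 0) {z : Fin 2 → ℝ} (hx : z 0 < 1 / 2)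
    (hy : 0 < z 1) : ‖gKDer α β l m ((z 0 : ℂ) + z 1 * I)‖ ≤ profK α β l m ‖z‖ := by
  set ζ : ℂ := (z 0 : ℂ) + z 1 * I with hζ
  have hre : ζ.re = z 0 := by simp [hζ]
  have him : ζ.im = z 1 := by simp [hζ]
  have hr0 : 0 < ‖z‖ :=
    lt_of_lt_of_le (by rw [Real.norm_eq_abs, abs_of_pos hy]; exact hy) (norm_le_pi_norm z 1)
  have hrz : ‖z‖ ≤ ‖ζ‖ := by
    refine (pi_norm_le_iff_of_nonneg (norm_nonneg ζ)).mpr fun i => ?_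
    fin_cases i
    · simpa [hre, Real.norm_eq_abs] using abs_re_le_norm ζ
    · simpa [him, Real.norm_eq_abs] using abs_im_le_norm ζ
  have hζpos : 0 < ‖ζ‖ := lt_of_lt_of_le hr0 hrz
  have hxζ : ζ.re < 1 / 2 := by rw [hre]; exact hx
  have hyζ : 0 < ζ.im := by rw [him]; exact hy
  have hcr := norm_gKDer_le_crude l m hs hs0 hxζ
  have hP := norm_gTwoDer_le_prof₂ hα hα0 hβ hβ0 hx hy
  have hB0 : 0 ≤ crudeK l m := by rw [crudeK]; positivity
  rw [profK]
  split_ifs with hr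
  · -- `r ≤ 1`
    have hP' : ‖gTwoDer α β ζ‖ ≤ 6 * ‖z‖ ^ (α + β - 1) := by
      have h := hP
      rw [prof₂, if_pos hr] at h
      exact h.trans (mul_le_mul_of_nonneg_left
        (Real.rpow_le_rpow_of_exponent_ge hr0 hr (by linarith)) (by norm_num))
    have hA : ‖ζ‖ ^ (α + β - 1) ≤ ‖z‖ ^ (α + β - 1) :=
      Real.rpow_le_rpow_of_nonpos hr0 hrz (by linarith)
    have hone : 1 ≤ ‖z‖ ^ (α + β - 1) :=
      Real.one_le_rpow_of_pos_of_le_one_of_nonpos hr0 hr (by linarith)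
    calc ‖gKDer α β l m ζ‖ ≤ _ := hcr
      _ ≤ 6 * ‖z‖ ^ (α + β - 1) + |l| * ‖z‖ ^ (α + β - 1) + 8 * |m| * ‖z‖ ^ (α + β - 1) := by
          refine add_le_add (add_le_add hP' (mul_le_mul_of_nonneg_left hA (abs_nonneg l))) ?_
          nlinarith [abs_nonneg m]
      _ = crudeK l m * ‖z‖ ^ (α + β - 1) := by rw [crudeK]; ring
  · push Not at hr
    have hfarC : 0 ≤ 16 * (2 + |m|) * ‖z‖ ^ (α + β - 2) := by positivity
    have hcrC : 0 ≤ 8 * crudeK l m * ‖z‖ ^ (α + β - 2) := by positivity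
    by_cases h2 : 2 ≤ ‖ζ‖
    · have hfar := norm_gKDer_le_far hα hα0 hβ hβ0 hs hs0 hK hyζ h2
      have hA : ‖ζ‖ ^ (α + β - 2) ≤ ‖z‖ ^ (α + β - 2) :=
        Real.rpow_le_rpow_of_nonpos hr0 hrz (by linarith)
      calc ‖gKDer α β l m ζ‖ ≤ 16 * (2 + |m|) * ‖ζ‖ ^ (α + β - 2) := hfar
        _ ≤ 16 * (2 + |m|) * ‖z‖ ^ (α + β - 2) := by gcongr
        _ ≤ _ := by nlinarith
    · push Not at h2
      have hz2 : ‖z‖ ≤ 2 := hrz.trans h2.le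
      have hP' : ‖gTwoDer α β ζ‖ ≤ 6 := by
        have h := hP
        rw [prof₂, if_neg (not_le.mpr hr)] at h
        have hD : ‖z‖ ^ (α + β - 1) ≤ 1 :=
          Real.rpow_le_one_of_one_le_of_nonpos hr.le (by linarith)
        exact h.trans (by nlinarith [hD])
      have hA : ‖ζ‖ ^ (α + β - 1) ≤ 1 :=
        Real.rpow_le_one_of_one_le_of_nonpos (by linarith) (by linarith)
      have hlow : 1 / 8 ≤ ‖z‖ ^ (α + β - 2) := by
        calc (1 / 8 : ℝ) = (1 / 2) ^ ((3 : ℕ) : ℝ) := by rw [Real.rpow_natCast]; norm_num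
          _ ≤ (1 / 2 : ℝ) ^ (-(α + β - 2)) :=
              Real.rpow_le_rpow_of_exponent_ge (by norm_num) (by norm_num) (by push_cast; linarith)
          _ = 2 ^ (α + β - 2) := by
              rw [one_div, Real.inv_rpow (by norm_num), Real.rpow_neg (by norm_num), inv_inv]
          _ ≤ ‖z‖ ^ (α + β - 2) := Real.rpow_le_rpow_of_nonpos hr0 hz2 (by linarith)
      calc ‖gKDer α β l m ζ‖ ≤ _ := hcr
        _ ≤ 6 + |l| * 1 + 8 * |m| := by gcongr
        _ = crudeK l m := by rw [crudeK]; ring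
        _ ≤ 8 * crudeK l m * ‖z‖ ^ (α + β - 2) := by nlinarith
        _ ≤ _ := by nlinarith

/-- The radial profile is integrable in the plane for `-1 < σ < 0`. -/
theorem integrable_profK {α β : ℝ} (l m : ℝ) (hs : -1 < α + β) (hs0 : α + β < 0) :
    Integrable (fun z : Fin 2 → ℝ => profK α β l m ‖z‖) := by
  refine (integrable_fun_norm_addHaar volume).mpr ?_
  have hdim : Module.finrank ℝ (Fin 2 → ℝ) - 1 = 1 := by simp
  rw [hdim, ← Ioc_union_Ioi_eq_Ioi zero_le_one, integrableOn_union]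
  simp only [pow_one, smul_eq_mul]
  constructor
  · have h := (intervalIntegral.intervalIntegrable_rpow' hs (a := 0) (b := 1)).const_mul
      (crudeK l m)
    rw [intervalIntegrable_iff_integrableOn_Ioc_of_le zero_le_one] at h
    refine h.congr_fun (fun y hy => ?_) measurableSet_Ioc
    show crudeK l m * y ^ (α + β) = y * profK α β l m y
    have hy0 : y ≠ 0 := hy.1.ne'
    rw [profK, if_pos hy.2, Real.rpow_sub_one hy0, mul_div_assoc' (crudeK l m),
      mul_div_cancel₀ _ hy0]
  · have h : IntegrableOn (fun y : ℝ => (8 * crudeK l m + 16 * (2 + |m|)) * y ^ (α + β - 1))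
        (Ioi 1) :=
      (integrableOn_Ioi_rpow_of_lt (by linarith) zero_lt_one).const_mul _
    refine h.congr_fun (fun y hy => ?_) measurableSet_Ioi
    have hy1 : (1 : ℝ) < y := hy
    have hy0 : y ≠ 0 := by linarith
    show (8 * crudeK l m + 16 * (2 + |m|)) * y ^ (α + β - 1) = y * profK α β l m y
    rw [profK, if_neg (not_le.mpr hy1), show α + β - 2 = (α + β - 1) - 1 by ring,
      Real.rpow_sub_one hy0 (α + β - 1), mul_div_assoc' (8 * crudeK l m + 16 * (2 + |m|)),
      mul_div_cancel₀ _ hy0]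

/-! ## Integrability of `h = Re g'` on the half-plane -/

/-- `Re g'(x+iy)` is continuous on `D`. -/
theorem continuousOn_re_gKDer (α β l m : ℝ) :
    ContinuousOn (fun z : Fin 2 → ℝ => (gKDer α β l m ((z 0 : ℂ) + z 1 * I)).re) Dom := by
  intro z hz
  have hs := mem_slitPlane_pair (x := z 0) hz.2
  have hlin : Continuous fun w : Fin 2 → ℝ => (w 0 : ℂ) + w 1 * I := by fun_prop
  have h := (continuousAt_gKDer α β l m hs.1 hs.2).comp
    (f := fun w : Fin 2 → ℝ => (w 0 : ℂ) + w 1 * I) hlin.continuousAt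
  exact (Complex.continuous_re.continuousAt.comp h).continuousWithinAt

/-- **`Re g'` is absolutely integrable on `D`** for `α, β ∈ [-1, 0]`, `-1 < σ < 0`, under the
cancellation conditions. -/
theorem integrableOn_re_gKDer {α β l m : ℝ} (hα : -1 ≤ α) (hα0 : α ≤ 0) (hβ : -1 ≤ β)
    (hβ0 : β ≤ 0) (hs : -1 < α + β) (hs0 : α + β < 0)
    (hK : ephase β - l - m * ephase (α + β) = 0) :
    IntegrableOn (fun z : Fin 2 → ℝ => (gKDer α β l m ((z 0 : ℂ) + z 1 * I)).re) Dom := by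
  refine Integrable.mono' (integrable_profK l m hs hs0).integrableOn
    ((continuousOn_re_gKDer α β l m).aestronglyMeasurable isOpen_Dom.measurableSet) ?_
  refine (ae_restrict_iff' isOpen_Dom.measurableSet).mpr (Eventually.of_forall fun z hz => ?_)
  rw [Real.norm_eq_abs]
  exact (abs_re_le_norm _).trans
    (norm_gKDer_le_profK hα hα0 hβ hβ0 hs.le hs0.le hK hz.1 hz.2)

end SoloBlind

end Summit.KontsevichZagierPeriods.KontsevichZagierPeriods.Theorems
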